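import Mathlib
import Literature.Computability.MetaComplexity.SmolenskyProperty
import Literature.Computability.Complexity.ThresholdMonotoneKWDepth
import HarnessLib

/-!
# Razborov's lemma: low-degree `𝔽₂`-polynomials are far from threshold functions

S. Jukna, *Extremal Combinatorics — with applications in computer science* (1st ed., Springer 2001)
[Jukna2001], Chapter 14 "The basic method", §14.2.2 "Inclusion matrices": Lemma 14.8 (Razborov
1987) with the proof of Lovász–Shmoys–Tardos (1995) printed there (Claim 14.9);
original: A. A. Razborov, *Lower bounds on the size of bounded depth circuits over a complete basis
with logical addition*, Mat. Zametki 41 (1987) 598–607 [Razborov1987].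

**Lemma 14.8 (Razborov 1987).** Let `n/2 ≤ k ≤ n`. Every polynomial of degree at most
`2k − n − 1` over `𝔽₂` differs from the `k`-threshold function `T_k^n` on at least `C(n,k)`
inputs.

Printed proof: let `U` be the set of inputs where the polynomial `g` differs from `T_k^n` and `A`
the set of inputs with exactly `k` ones; the `0`-`1` matrix `M = (m_{a,u})`, `m_{a,u} = [a ≥ u]`,
has columns spanning `𝔽₂^A`, because (Claim 14.9) for `U_a = {u ∈ U : u ≤ a}`,
`Σ_{u ∈ U_a} m_{b,u} = Σ_{x ≤ a ∧ b} (T_k^n(x) + g(x)) = [b = a]`: the `g`-sum vanishes since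
`a ∧ b` has at least `2k − n ≥ d + 1` ones (a monomial `x_S`, `|S| ≤ d`, has `2^{|a∧b|−|S|}`, an
even number, of points `x ≤ a ∧ b` with `x_S(x) = 1` — Exercise 14.16), and the `T_k^n`-sum is
`[a = b]`.  Hence `|U| ≥ |A| = C(n,k)`.

PROVED here (theorems only, no named facts) in the tree's vocabulary: functions on the cube
`Smolensky.CubeFn (ZMod 2) n = (Fin n → Bool) → ZMod 2`, the degree filtration
`Smolensky.lowDeg (ZMod 2) n D` spanned by the multilinear monomials `Smolensky.mono`
(`SmolenskyProperty.lean`), and `thresholdFn n k` (`ThresholdMonotoneKWDepth.lean`).  Points of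
the cube are handled through their supports: `x_s = (i ↦ [i ∈ s])` for `s : Finset (Fin n)`.
* `mono_ofSet`, `thresholdFn_ofSet`, `card_filter_ne_eq_card_filter_ofSet` — the dictionary;
* `sum_mono_ofSet_powerset` (Exercise 14.16: `Σ_{x ⊆ c} x_S(x) = 0` in `𝔽₂` when `|S| < |c|`),
  `sum_lowDeg_ofSet_powerset` (the same for every `g` of degree `< |c|`),
  `sum_threshold_ofSet_powerset` (`Σ_{x ⊆ c} T_k(x) = [|c| = k]` for `|c| ≤ k`);
* `ne_indicator_eq_add` — in `𝔽₂`, `[g ≠ T] = T + g`;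
* **`razborov_threshold_approximation`** — Lemma 14.8: `M·Mᵀ = 1` (Claim 14.9), so
  `C(n,k) = rk 1 ≤ rk M ≤ |U|`.

(The tree's `SmolenskyCorrelation.majority_agreement_le` is the different Smolensky-type bound
`≤ 2^{n−1} + D·C(n, n/2)` for the agreement with MAJORITY over any field.)

## References

* [Jukna2001] S. Jukna, *Extremal Combinatorics*, 1st ed., Springer (2001), Lemma 14.8, Claim 14.9
  and Exercise 14.16 (held text
  `book:jukna2011-extremal-combinatorics-with-applications-computer-science`, chunks 173–174, 187).
* [Razborov1987] A. A. Razborov, Mat. Zametki 41 (1987) 598–607 (Math. Notes 41, 333–338).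
* L. Lovász, D. B. Shmoys, É. Tardos, *Combinatorics in computer science*, in: Handbook of
  Combinatorics (1995) — the printed proof (cited by [Jukna2001]).
-/

namespace Literature.Computability.MetaComplexity

open Finset Smolensky Literature.Computability.Complexity

variable {n : ℕ}

/-! ### The dictionary between points of the cube and their supports -/

/-- `x_S` at the point `x_s = (i ↦ [i ∈ s])` is `[S ⊆ s]`. [cite: Jukna2001, Ch. 14 §14.2.2,
proof of Lemma 14.8 ("`m_{a,u} = 1` if and only if `a ≥ u`")] -/
theorem mono_ofSet (S s : Finset (Fin n)) :
    mono (ZMod 2) S (fun i => decide (i ∈ s)) = if S ⊆ s then 1 else 0 := by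
  rw [mono_apply]
  congr 1
  simp [Finset.subset_iff]

/-- The number of ones of `x_s` is `|s|` (0-1 vectors of length `n` with exactly `k` 1's ↔
`k`-subsets). [cite: Jukna2001, Ch. 14 §14.2.2, proof of Lemma 14.8 ("the set of all 0-1 vectors
of length `n` containing exactly `k` 1's")] -/
theorem hammingWeight_ofSet (s : Finset (Fin n)) :
    hammingWeight (fun i => decide (i ∈ s)) = s.card := by
  unfold hammingWeight
  congr 1
  ext i
  simp

/-- `T_k^n(x_s) = [k ≤ |s|]`. [cite: Jukna2001, Ch. 14 §14.2.2 ("outputs 1 if and only if at least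
`k` of the bits in the input vector are 1")] -/
theorem thresholdFn_ofSet (k : ℕ) (s : Finset (Fin n)) :
    thresholdFn n k (fun i => decide (i ∈ s)) = decide (k ≤ s.card) := by
  rw [thresholdFn, hammingWeight_ofSet]

/-- Every point of the cube is `x_s` for its support `s` (the identification of 0-1 vectors with
sets used throughout the printed proof: `a ≥ u`, `a ∧ b`). [cite: Jukna2001, Ch. 14 §14.2.2,
proof of Lemma 14.8] -/
theorem ofSet_support (x : Fin n → Bool) :
    (fun i => decide (i ∈ Finset.univ.filter (fun j => x j = true))) = x := by
  funext i
  cases h : x i <;> simp [h]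

/-- Counting inputs by their supports: `|{x : p x}| = |{s : p (x_s)}|` (inputs ↔ subsets of
`[n]`). [cite: Jukna2001, Ch. 14 §14.2.2, proof of Lemma 14.8 ("let `U` denote the set of all
vectors where it differs from `T_k^n`")] -/
theorem card_filter_eq_card_filter_ofSet (p : (Fin n → Bool) → Prop) [DecidablePred p] :
    (Finset.univ.filter p).card =
      (Finset.univ.filter (fun s : Finset (Fin n) => p (fun i => decide (i ∈ s)))).card := by
  refine Finset.card_bij (fun x _ => Finset.univ.filter (fun j => x j = true)) ?_ ?_ ?_
  · intro x hx
    rw [Finset.mem_filter] at hx ⊢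
    exact ⟨Finset.mem_univ _, by rw [ofSet_support]; exact hx.2⟩
  · intro x _ y _ hxy
    rw [← ofSet_support x, ← ofSet_support y, hxy]
  · intro s hs
    refine ⟨fun i => decide (i ∈ s), ?_, ?_⟩
    · rw [Finset.mem_filter] at hs ⊢
      exact ⟨Finset.mem_univ _, hs.2⟩
    · ext i; simp

/-! ### Claim 14.9: the sums over the points below `a ∧ b` -/

/-- **Exercise 14.16.** For a monomial `x_S` with `|S| < |c|`, `Σ_{x ≤ c} x_S(x) = 0` over `𝔽₂`
(there are `2^{|c|−|S|}` points `x` with `S ⊆ x ⊆ c`, an even number).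
[cite: Jukna2001, Ch. 14 Exercise 14.16 and proof of Claim 14.9] -/
theorem sum_mono_ofSet_powerset (S c : Finset (Fin n)) (hSc : S.card < c.card) :
    ∑ s ∈ c.powerset, mono (ZMod 2) S (fun i => decide (i ∈ s)) = 0 := by
  simp_rw [mono_ofSet]
  rw [Finset.sum_boole]
  by_cases hS : S ⊆ c
  · have hI : c.powerset.filter (fun s => S ⊆ s) = Finset.Icc S c := by
      ext s
      simp only [Finset.mem_filter, Finset.mem_powerset, Finset.mem_Icc]
      tauto
    rw [hI, Finset.card_Icc_finset hS]
    obtain ⟨m, hm⟩ : ∃ m, c.card - S.card = m + 1 := ⟨c.card - S.card - 1, by omega⟩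
    rw [hm, pow_succ]
    push_cast
    rw [show (2 : ZMod 2) = 0 from rfl, mul_zero]
  · have h0 : c.powerset.filter (fun s => S ⊆ s) = ∅ := by
      refine Finset.filter_false_of_mem fun s hs hSs => hS ?_
      exact hSs.trans (Finset.mem_powerset.mp hs)
    rw [h0, Finset.card_empty, Nat.cast_zero]

/-- For a polynomial `g` of degree `≤ d < |c|` over `𝔽₂`, `Σ_{x ≤ c} g(x) = 0`.
[cite: Jukna2001, Ch. 14 §14.2.2, proof of Claim 14.9 ("The second term … is 0, since `a ∧ b` has
at least `d + 1` 1's")] -/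
theorem sum_lowDeg_ofSet_powerset {d : ℕ} {g : CubeFn (ZMod 2) n} (hg : g ∈ lowDeg (ZMod 2) n d)
    (c : Finset (Fin n)) (hc : d < c.card) :
    ∑ s ∈ c.powerset, g (fun i => decide (i ∈ s)) = 0 := by
  induction hg using Submodule.span_induction with
  | mem x hx =>
    obtain ⟨⟨S, hS⟩, rfl⟩ := hx
    exact sum_mono_ofSet_powerset S c (hS.trans_lt hc)
  | zero => simp
  | add x y _ _ hx hy =>
    simp only [Pi.add_apply, Finset.sum_add_distrib, hx, hy, add_zero]
  | smul a x _ hx =>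
    simp only [Pi.smul_apply, smul_eq_mul, ← Finset.mul_sum, hx, mul_zero]

/-- For `|c| ≤ k`, `Σ_{x ≤ c} T_k^n(x) = [|c| = k]` (only `x = c` can reach the threshold).
[cite: Jukna2001, Ch. 14 §14.2.2, proof of Claim 14.9 ("The first term is also 0 except if
`a = b`")] -/
theorem sum_threshold_ofSet_powerset (k : ℕ) (c : Finset (Fin n)) (hc : c.card ≤ k) :
    ∑ s ∈ c.powerset, (if thresholdFn n k (fun i => decide (i ∈ s)) then (1 : ZMod 2) else 0) =
      if c.card = k then 1 else 0 := by
  simp_rw [thresholdFn_ofSet, decide_eq_true_eq]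
  rw [Finset.sum_boole]
  by_cases hck : c.card = k
  · have h1 : c.powerset.filter (fun s => k ≤ s.card) = {c} := by
      ext s
      simp only [Finset.mem_filter, Finset.mem_powerset, Finset.mem_singleton]
      constructor
      · rintro ⟨hs, hk⟩
        exact Finset.eq_of_subset_of_card_le hs (by omega)
      · rintro rfl; exact ⟨Finset.Subset.refl _, hck.ge⟩
    rw [h1, Finset.card_singleton, if_pos hck, Nat.cast_one]
  · have h0 : c.powerset.filter (fun s => k ≤ s.card) = ∅ := by
      refine Finset.filter_false_of_mem fun s hs hk => hck ?_
      have := Finset.card_le_card (Finset.mem_powerset.mp hs)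
      omega
    rw [h0, Finset.card_empty, if_neg hck, Nat.cast_zero]

/-- In `𝔽₂`, the indicator of `g ≠ T` is `T + g`. [cite: Jukna2001, Ch. 14 §14.2.2, proof of
Claim 14.9 ("`Σ_{u ∈ U, u ≤ a∧b} 1 = Σ_{x ≤ a∧b} (T_k^n(x) + g(x))`")] -/
theorem ne_indicator_eq_add (a b : ZMod 2) : (if a ≠ b then (1 : ZMod 2) else 0) = b + a := by
  revert a b
  decide

/-! ### Lemma 14.8 -/

/-- **Lemma 14.8 (Razborov 1987).** Let `n/2 ≤ k ≤ n` and let `g` be a polynomial over `𝔽₂` of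
degree at most `2k − n − 1` (here: `g ∈ lowDeg (ZMod 2) n d` with `d + n + 1 ≤ 2k`). Then `g`
differs from the `k`-threshold function `T_k^n` on at least `C(n,k)` inputs.
[cite: Jukna2001, Ch. 14 §14.2.2, Lemma 14.8 and Claim 14.9; Razborov1987] -/
theorem razborov_threshold_approximation {k d : ℕ} (hd : d + n + 1 ≤ 2 * k)
    {g : CubeFn (ZMod 2) n} (hg : g ∈ lowDeg (ZMod 2) n d) :
    n.choose k ≤ (Finset.univ.filter fun x : Fin n → Bool =>
      g x ≠ if thresholdFn n k x then 1 else 0).card := by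
  classical
  -- work with supports: `U` = supports of the disagreement inputs, `A` = the `k`-sets
  rw [card_filter_eq_card_filter_ofSet]
  set pU : Finset (Fin n) → Prop := fun s =>
    g (fun i => decide (i ∈ s)) ≠ if thresholdFn n k (fun i => decide (i ∈ s)) then 1 else 0
    with hpU
  change n.choose k ≤ (Finset.univ.filter pU).card
  -- the matrix `M`
  let M : Matrix {a : Finset (Fin n) // a.card = k} {u : Finset (Fin n) // pU u} (ZMod 2) :=
    Matrix.of fun a u => if u.1 ⊆ a.1 then 1 else 0
  -- Claim 14.9: `M * Mᵀ = 1`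
  have hMM : M * M.transpose = 1 := by
    ext a b
    have hc_le : (a.1 ∩ b.1).card ≤ k :=
      (Finset.card_le_card Finset.inter_subset_left).trans a.2.le
    have hc_gt : d < (a.1 ∩ b.1).card := by
      have h1 := Finset.card_union_add_card_inter a.1 b.1
      have h2 : (a.1 ∪ b.1).card ≤ n := (Finset.card_le_univ _).trans (by simp)
      rw [a.2, b.2] at h1
      omega
    calc (M * M.transpose) a b
        = ∑ u : {u : Finset (Fin n) // pU u}, (if u.1 ⊆ a.1 ∩ b.1 then (1 : ZMod 2) else 0) := by
          simp only [Matrix.mul_apply, Matrix.transpose_apply, M, Matrix.of_apply, mul_boole]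
          refine Finset.sum_congr rfl fun u _ => ?_
          by_cases ha : u.1 ⊆ a.1 <;> by_cases hb : u.1 ⊆ b.1 <;>
            simp [ha, hb, Finset.subset_inter_iff]
      _ = ∑ s ∈ Finset.univ.filter pU, (if s ⊆ a.1 ∩ b.1 then (1 : ZMod 2) else 0) :=
          (Finset.sum_subtype (Finset.univ.filter pU) (by simp)
            (fun s => if s ⊆ a.1 ∩ b.1 then (1 : ZMod 2) else 0)).symm
      _ = ∑ s ∈ (a.1 ∩ b.1).powerset, (if pU s then (1 : ZMod 2) else 0) := by
          have hsets : (Finset.univ.filter pU).filter (fun s => s ⊆ a.1 ∩ b.1) =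
              (a.1 ∩ b.1).powerset.filter pU := by
            ext s
            simp only [Finset.mem_filter, Finset.mem_univ, true_and, Finset.mem_powerset]
            exact and_comm
          rw [Finset.sum_boole, Finset.sum_boole, hsets]
      _ = ∑ s ∈ (a.1 ∩ b.1).powerset,
            ((if thresholdFn n k (fun i => decide (i ∈ s)) then (1 : ZMod 2) else 0) +
              g (fun i => decide (i ∈ s))) := by
          refine Finset.sum_congr rfl fun s _ => ?_
          exact ne_indicator_eq_add _ _
      _ = (if (a.1 ∩ b.1).card = k then 1 else 0) + 0 := by
          rw [Finset.sum_add_distrib, sum_threshold_ofSet_powerset k _ hc_le,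
            sum_lowDeg_ofSet_powerset hg _ hc_gt]
      _ = (1 : Matrix _ _ (ZMod 2)) a b := by
          rw [add_zero, Matrix.one_apply]
          by_cases hab : a = b
          · subst hab
            rw [if_pos (by rw [Finset.inter_self]; exact a.2), if_pos rfl]
          · rw [if_neg, if_neg hab]
            intro hcard
            apply hab
            have h1 : a.1 ∩ b.1 = a.1 :=
              Finset.eq_of_subset_of_card_le Finset.inter_subset_left (by rw [hcard, a.2])
            have h2 : a.1 ∩ b.1 = b.1 :=
              Finset.eq_of_subset_of_card_le Finset.inter_subset_right (by rw [hcard, b.2])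
            exact Subtype.ext (h1.symm.trans h2)
  -- ranks: `C(n,k) = rk 1 = rk (M Mᵀ) ≤ rk M ≤ |U|`
  have hA : Fintype.card {a : Finset (Fin n) // a.card = k} = n.choose k := by
    rw [Fintype.card_subtype]
    have : Finset.univ.filter (fun a : Finset (Fin n) => a.card = k) =
        Finset.powersetCard k Finset.univ := by
      ext a; simp [Finset.mem_powersetCard]
    rw [this, Finset.card_powersetCard, Finset.card_univ, Fintype.card_fin]
  have hU : Fintype.card {u : Finset (Fin n) // pU u} = (Finset.univ.filter pU).card :=
    Fintype.card_subtype _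
  have h1 : (M * M.transpose).rank = n.choose k := by rw [hMM, Matrix.rank_one, hA]
  have h2 := Matrix.rank_mul_le_left M M.transpose
  have h3 := Matrix.rank_le_card_width M
  rw [← hU]
  omega

end Literature.Computability.MetaComplexity
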